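import Summits.HodgeConjecture.HodgeConjecture.Theorems.MarkmanPartnerTransportPicardThreeK3SquaresOneCycleOfOpenAll
import Summits.HodgeConjecture.HodgeConjecture.Theorems.MarkmanPartnerTransportPicardThreeK3SquaresOddPicardRMLoci
import Summits.HodgeConjecture.HodgeConjecture.Theorems.MarkmanPartnerTransportPicardThreeK3SquaresOneCycleDegreeHodge
import Summits.HodgeConjecture.HodgeConjecture.Theorems.MarkmanPartnerTransportPicardThreeK3SquaresZeta9TypeOfConj
import HarnessLib

/-!
# Route MarkmanPartnerTransport · crux `PicardThreeK3Squares` (stmt-HodgeConjecture-19652) —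
# HC⁴(S ⊗ S) for EVERY K3 surface on the ζ₉ and ζ₁₁ real-multiplication Hodge loci — all Picard
# numbers, hypotheses on `S` = marking + position of the period ONLY

Cell hodge-nonav, crux #4 (HC⁴(S ⊗ S), ρ(S) ≥ 3; open core: real multiplication), programme «RATIONAL ORBIT
DENSITY» — CAPSTONE of the sub-type line of gen 20 (prover seat hodge-nonav-19652-p1; `--supports
stmt-HodgeConjecture-19652`, helper). CONDITIONAL on the named facts `Buskin2019_hodgeIsometry_algebraic`,
`Huybrechts_K3_marking_exists` and the ∀-member van Geemen–Schütt facts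
`VanGeemenSchuett2025_zeta9_cycleOnOpenPeriodSet_everyMember` ∕
`VanGeemenSchuett2025_OguisoZhang2011_zeta11_cycleOnOpenPeriodSet_everyMember`; credits nothing; nothing here
says HC is proved; rung F-H1 not moved.

THE POINT. The transported cycle (`exists_oneCycle_of_openAll`, `…OneCycleOfOpenAll`) is ONE rational,
type-preserving, cycle-induced endomorphism `Θ` of `H²(S)` whose `(2,0)`-eigenvalue is the model eigenvalue
`e₀` — of degree `3` over `ℚ` for ζ₉ (`2cos(2π/9)`, minimal polynomial `X³ - 3X + 1`) and of degree `5` for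
ζ₁₁ (`2cos(2π/11)`). Gen 8's ONE-CYCLE DEGREE LAW
(`OneCycle.hodgeConjectureFor_square_of_oneCycle_natDegree_of_buskin`: an eigenvalue of degree `k` with
`k·j·m + ρ(S) ≠ 22` for all `j ≥ 2`, `m ≥ 3` generates `End_Hdg T(S)` unless `S` is CM, where Buskin's
theorem applies) then needs NO restriction on the Picard number: for `k = 5` the condition is empty
(`5jm ≥ 30`), for `k = 3` it says `ρ(S) ≠ 4`, and every surface on the ζ₉ locus has `ρ(S) ≥ 10`
(`ten_le_finrank_algebraicClasses_of_zeta9Locus`: the ten-dimensional `ker θ_ℂ` is spanned by rational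
vectors orthogonal to the period, i.e. by images of divisor classes). Hence:

* `ten_le_finrank_algebraicClasses_of_zeta9Locus` — `ρ(S) ≥ 10` for every marked K3 surface whose period
  lies (after a rational isometry) on the ζ₉ Hodge locus.
* **`exists_zeta9Locus_hodgeConjectureFor_square`** — THERE IS a ζ₉ datum `(g, y₀, θ)` such that EVERY
  marked projective K3 surface `(S, η, p, x)` and every rational isometry `σ` of `Λ_ℚ` with
  `θ_ℂ(σx) = 2cos(2π/9)·σx` satisfy `HodgeConjectureFor 4 (S ⊗ S)` — every point of the ζ₉ locus: the very
  general ones (`ρ = 10`, gen 12), the Noether–Lefschetz-special ones (`ρ = 13`, RungRank13) and the CM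
  points (`ρ = 16`) in ONE statement with NO endomorphism ∕ polynomial ∕ generation ∕ conjugation ∕
  Picard-number hypothesis.
* **`hodgeConjectureFor_square_of_zeta11Locus`** — for every ζ₁₁ datum `(g, u₁, u₂, y₀, θ)`, EVERY marked
  projective K3 surface and every rational isometry `σ` with `θ_ℂ(σx) = 2cos(2π/11)·σx` satisfy
  `HodgeConjectureFor 4 (S ⊗ S)` — every point of the ζ₁₁ locus (`ρ = 2` gen 11, `ρ = 7` terminal type
  (7,5,3), `ρ = 12` CM points).

Which K3 surfaces lie on these loci (Witt over `ℚ`, not formalised): those whose transcendental lattice,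
with its real multiplication, embeds isometrically and equivariantly into the model — for the NL-special
ones a lattice-representation CONDITION over `F` (Hasse–Minkowski). No definition, no sorry, no new named
fact. References: van Geemen–Schütt, Forum Math. Sigma 13 (2025) e2, Thm. 1.1 (9), (11), §2.4–2.6, §3.4,
§4.8, §5.6, §5.8, §6.6; Oguiso–Zhang, Pure Appl. Math. Q. 7 (2011), Thm. 1.5; van Geemen, Michigan Math. J.
56 (2008) Lemma 3.2; Zarhin, J. reine angew. Math. 341 (1983) Thm. 1.5.1; Buskin, J. reine angew. Math. 755
(2019), Thm. 1.1; Huybrechts, *Lectures on K3 Surfaces*, Ch. 3 Cor. 3.6, Ch. 6 Prop. 1.2/1.5.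
-/

set_option linter.dupNamespace false

noncomputable section

namespace Summit.HodgeConjecture.HodgeConjecture.Theorems.MarkmanPartnerTransport.RMTypeOrbit

open CategoryTheory MonoidalCategory Polynomial
open Literature.AlgebraicGeometry Literature.AlgebraicGeometry.Motives Literature.AlgebraicGeometry.HodgeTheory
open Literature.AlgebraicGeometry.Surfaces Literature.LinearAlgebra.QuadraticForm
open Literature.AlgebraicTopology.SingularHomology
open Summit.HodgeConjecture.HodgeConjecture.Theorems.NikulinTwinTransport
open Summit.HodgeConjecture.HodgeConjecture.Theorems.MarkmanPartnerTransport.IsogenyInvariance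
open Summit.HodgeConjecture.HodgeConjecture.Theorems.MarkmanPartnerTransport.RMTypeDescent

/-- `MarkedK3[S, η, p, x]`: VERBATIM the `let MarkedK3 := …` binder of the route declaration
`PicardThreeK3Squares` (as in `…RMTypeDescent`). Local notation only. -/
local notation3 (prettyPrint := false) "MarkedK3[" S ", " η ", " p ", " x "]" =>
  (p ≠ 0 ∧ (IsIntegralClass p ∧
    (∀ q : complexBetti S (2 * 2), IsIntegralClass q → ∃ n : ℤ, q = n • p) ∧
    (∀ c : complexBetti S (2 * 1), IsIntegralClass c ↔ ∃ v : K3Index → ℤ, η c = fun i => (v i : ℂ)) ∧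
    (∀ a b : complexBetti S (2 * 1),
      cupProduct (rfl : 2 * 1 + 2 * 1 = 2 * 2) a b = k3Form (η a) (η b) • p) ∧
    IsOfHodgeType 2 S (2 * 1) 2 0 (LinearEquiv.symm η x) ∧
    (∀ τ : complexBetti S (2 * 1), IsOfHodgeType 2 S (2 * 1) 2 0 τ →
      ∃ t : ℂ, τ = t • LinearEquiv.symm η x)) ∧
    (k3Form x x = 0 ∧ 0 < (k3Form (star x) x).re ∧
      ∃ u : K3Index → ℤ, k3Form (fun i => (u i : ℂ)) x = 0 ∧ 0 < ∑ i, ∑ j, u i * k3Gram i j * u j))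

variable {S : SchemeOver ℂ}

/-- `CycleAll[θ, e, U]`: the STRONG ∃-form open-set input — at EVERY period point of `D_{θ,e}` in `U`
(`θ`-generic OR NOT) there is a marked projective K3 surface carrying an algebraic class inducing
`η'⁻¹ θ_ℂ η'`. (`CycleEx[θ, e, U]` of `…RMTypeOpenExists` is the same clause restricted to `θ`-generic
periods.) Local notation only. -/
local notation3 (prettyPrint := false) "CycleAll[" θ ", " e ", " U "]" =>
  (∀ y : K3Index → ℂ, y ∈ U → thetaC θ y = (e : ℂ) • y → k3Form y y = 0 → 0 < (k3Form (star y) y).re →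
    ∃ (S' : SchemeOver ℂ) (hS' : IsK3Surface S') (η' : complexBetti S' (2 * 1) ≃ₗ[ℂ] (K3Index → ℂ))
      (p' : complexBetti S' (2 * 2)), MarkedK3[S', η', p', y] ∧
      ∃ γ' ∈ algebraicClasses (S' ⊗ S') 2, ∀ z : complexBetti S' (2 * 1),
        (η'.symm.toLinearMap ∘ₗ (thetaC θ ∘ₗ η'.toLinearMap)) z =
          complexGysin complexOrientationFamily
            (IsSmoothProjective.tensor_holds hS'.isSmoothProjective hS'.isSmoothProjective)
            hS'.isSmoothProjective (SemiCartesianMonoidalCategory.fst S' S')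
            (rfl : 2 * 1 + 2 * 2 + 2 * 2 = 2 * 1 + 2 * (2 + 2))
            (cupProduct (rfl : 2 * 1 + 2 * 2 = 2 * 1 + 2 * 2)
              (complexBetti.map (SemiCartesianMonoidalCategory.snd S' S') (2 * 1) z) γ'))

/-- `OpenAll[θ, e]`: there is an open `U ⊂ Λ_ℂ` containing a `θ`-GENERIC period point of `D_{θ,e}` on
which `CycleAll[θ, e, U]` holds. Local notation only. -/
local notation3 (prettyPrint := false) "OpenAll[" θ ", " e "]" =>
  (∃ U : Set (K3Index → ℂ), IsOpen U ∧
    (∃ y₁ ∈ U, thetaC θ y₁ = (e : ℂ) • y₁ ∧ k3Form y₁ y₁ = 0 ∧ 0 < (k3Form (star y₁) y₁).re ∧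
      ∀ v : K3Index → ℚ, k3Form (fun i => (v i : ℂ)) y₁ = 0 → Matrix.mulVec θ v = 0) ∧
    CycleAll[θ, e, U])

/-- `Zeta9Model[g, y₀, θ]`: VERBATIM the datum conjuncts of the named fact
`VanGeemenSchuett2025_zeta9_cycleOnOpenPeriodSet` (as in `…Zeta9Type`). Local notation only. -/
local notation3 (prettyPrint := false) "Zeta9Model[" g ", " y₀ ", " θ "]" =>
  ((∀ a b : K3Index → ℂ, k3Form (g a) (g b) = k3Form a b) ∧
    (∀ v : K3Index → ℤ, ∃ w : K3Index → ℤ,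
      g (fun i => ((v i : ℤ) : ℂ)) = fun i => ((w i : ℤ) : ℂ)) ∧
    g ^ 9 = 1 ∧
    Module.finrank ℂ (LinearMap.ker (g ^ 3 - 1)) = 10 ∧
    k3Form y₀ y₀ = 0 ∧ 0 < (k3Form (star y₀) y₀).re ∧
    g y₀ = Complex.exp (2 * Real.pi * Complex.I / 9) • y₀ ∧
    (∀ y : K3Index → ℂ, thetaC θ y =
      (1 / 3 : ℂ) • ((2 : ℂ) • g y + (2 : ℂ) • (g ^ 8) y - (g ^ 2) y - (g ^ 4) y - (g ^ 5) y
        - (g ^ 7) y)))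

/-- The cubic `X³ - 3X + 1 ∈ ℚ[X]` (minimal polynomial of `2cos(2π/9)`). Local notation only. -/
local notation3 (prettyPrint := false) "P₉" => (X ^ 3 - C (3 : ℚ) * X + 1 : ℚ[X])

/-- `Zeta11Model[g, u₁, u₂, y₀, θ]`: VERBATIM the antecedents of the named fact
`VanGeemenSchuett2025_OguisoZhang2011_zeta11_cycleOnOpenPeriodSet` (as in `…PicardThreeK3SquaresZeta11Type`).
Local notation only. -/
local notation3 (prettyPrint := false) "Zeta11Model[" g ", " u₁ ", " u₂ ", " y₀ ", " θ "]" =>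
  ((∀ a b : K3Index → ℂ, k3Form (g a) (g b) = k3Form a b) ∧
    (∀ v : K3Index → ℤ, ∃ w : K3Index → ℤ,
      g (fun i => ((v i : ℤ) : ℂ)) = fun i => ((w i : ℤ) : ℂ)) ∧
    g ^ 11 = 1 ∧
    g (fun i => ((u₁ i : ℤ) : ℂ)) = (fun i => ((u₁ i : ℤ) : ℂ)) ∧
    g (fun i => ((u₂ i : ℤ) : ℂ)) = (fun i => ((u₂ i : ℤ) : ℂ)) ∧
    k3Form (fun i => ((u₁ i : ℤ) : ℂ)) (fun i => ((u₁ i : ℤ) : ℂ)) = 0 ∧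
    k3Form (fun i => ((u₂ i : ℤ) : ℂ)) (fun i => ((u₂ i : ℤ) : ℂ)) = 0 ∧
    k3Form (fun i => ((u₁ i : ℤ) : ℂ)) (fun i => ((u₂ i : ℤ) : ℂ)) = 1 ∧
    (∀ v : K3Index → ℤ, g (fun i => ((v i : ℤ) : ℂ)) = (fun i => ((v i : ℤ) : ℂ)) →
      ∃ m n : ℤ, v = m • u₁ + n • u₂) ∧
    k3Form y₀ y₀ = 0 ∧ 0 < (k3Form (star y₀) y₀).re ∧
    g y₀ = Complex.exp (2 * Real.pi * Complex.I / 11) • y₀ ∧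
    (∀ y : K3Index → ℂ, thetaC θ y =
      g y + (g ^ 10) y - (2 * k3Form y (fun i => ((u₂ i : ℤ) : ℂ))) • (fun i => ((u₁ i : ℤ) : ℂ))
        - (2 * k3Form y (fun i => ((u₁ i : ℤ) : ℂ))) • (fun i => ((u₂ i : ℤ) : ℂ))))

/-- `πU[u₁, u₂]`: the `k3Form`-orthogonal projector `y ↦ (y.u₂)u₁ + (y.u₁)u₂` onto the hyperbolic plane
`ℂu₁ ⊕ ℂu₂` (for `(u₁.u₁) = (u₂.u₂) = 0`, `(u₁.u₂) = 1`). Local notation only. -/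
local notation3 (prettyPrint := false) "πU[" u₁ ", " u₂ "]" =>
  ((LinearMap.smulRight (k3FormC (fun i : K3Index => ((u₂ i : ℤ) : ℂ))) (fun i : K3Index => ((u₁ i : ℤ) : ℂ)) +
      LinearMap.smulRight (k3FormC (fun i : K3Index => ((u₁ i : ℤ) : ℂ))) (fun i : K3Index => ((u₂ i : ℤ) : ℂ)) :
    Module.End ℂ (K3Index → ℂ)))

/-- `Q₁₁ = (X - 2)(X⁵ + X⁴ - 4X³ - 3X² + 3X + 1) ∈ ℚ[X]`: `X - 2` times the minimal polynomial of `ζ₁₁ + ζ₁₁⁻¹`.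
Local notation only. -/
local notation3 (prettyPrint := false) "Q₁₁" =>
  ((X - C (2 : ℚ)) * (X ^ 5 + X ^ 4 - C (4 : ℚ) * X ^ 3 - C (3 : ℚ) * X ^ 2 + C (3 : ℚ) * X + 1) : ℚ[X])

/-- The quintic `P₁₁ = X⁵ + X⁴ - 4X³ - 3X² + 3X + 1 ∈ ℚ[X]` (minimal polynomial of `2cos(2π/11)`).
Local notation only. -/
local notation3 (prettyPrint := false) "P₁₁" =>
  (X ^ 5 + X ^ 4 - C (4 : ℚ) * X ^ 3 - C (3 : ℚ) * X ^ 2 + C (3 : ℚ) * X + 1 : ℚ[X])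

/-- `LocusHC[θ, e]`: **HC⁴(S ⊗ S) for every marked projective K3 surface whose period is carried by a
rational isometry of `Λ_ℚ` onto the Hodge locus `D_{θ,e}`** — no other hypothesis. Local notation only. -/
local notation3 (prettyPrint := false) "LocusHC[" θ ", " e "]" =>
  (∀ (S : SchemeOver ℂ) (hS : IsK3Surface S)
    (η : complexBetti S (2 * 1) ≃ₗ[ℂ] (K3Index → ℂ)) (p : complexBetti S (2 * 2)) (x : K3Index → ℂ)
    (_hM : MarkedK3[S, η, p, x])
    (σ : Module.End ℂ (K3Index → ℂ)) (_hσ : ∀ a b, k3Form (σ a) (σ b) = k3Form a b)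
    (_hσrat : ∀ v : K3Index → ℤ, ∃ w : K3Index → ℚ, σ (fun i => (v i : ℂ)) = fun i => (w i : ℂ))
    (_heig : thetaC θ (σ x) = ((e : ℝ) : ℂ) • σ x),
    HodgeConjectureFor 4 (S ⊗ S))

variable {g : Module.End ℂ (K3Index → ℂ)} {u₁ u₂ : K3Index → ℤ} {y₀ : K3Index → ℂ}
  {θ : Matrix K3Index K3Index ℚ}

/-! ### The ζ₉ locus: `ρ(S) ≥ 10` and HC⁴ of every square -/

/-- **Every K3 surface on the ζ₉ Hodge locus has Picard number at least `10`.** For a ζ₉ datum and a marked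
projective K3 surface `(S, η, p, x)` with `θ_ℂ(σx) = e₀·σx` (`σ` a rational isometry, `e₀ = 2cos(2π/9)`):
the ten-dimensional `ker θ_ℂ` (`finrank_ker_thetaC_of_zeta9Model`) is spanned by rational vectors
(`ker_thetaC_le_span_ratCast`), each orthogonal to `σx` and to its conjugate (`θ` self-adjoint and real,
`e₀ ≠ 0` real), hence the image under `σ ∘ η` of a rational `(1,1)`-class — a divisor class by Lefschetz
`(1,1)`; so `ker θ_ℂ ⊆ ση(N¹(S)_ℂ)` and `10 ≤ ρ(S)`. Fact-free (Lefschetz `(1,1)` is a tree theorem).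
[cite: GeemenSchutt2023, Thm. 1.1 (9) and §2.4] [cite: Huybrechts2016K3, Ch. 1 Prop. 3.5 and Ch. 3 §3.2] -/
theorem ten_le_finrank_algebraicClasses_of_zeta9Locus (hZ : Zeta9Model[g, y₀, θ]) {S : SchemeOver ℂ}
    (hS : IsK3Surface S)
    (η : complexBetti S (2 * 1) ≃ₗ[ℂ] (K3Index → ℂ)) (p : complexBetti S (2 * 2)) (x : K3Index → ℂ)
    (hM : MarkedK3[S, η, p, x])
    (σ : Module.End ℂ (K3Index → ℂ)) (hσ : ∀ a b, k3Form (σ a) (σ b) = k3Form a b)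
    (hσrat : ∀ v : K3Index → ℤ, ∃ w : K3Index → ℚ, σ (fun i => (v i : ℂ)) = fun i => (w i : ℂ))
    (heig : thetaC θ (σ x) = (((2 * Real.cos (2 * Real.pi / 9) : ℝ)) : ℂ) • σ x) :
    10 ≤ Module.finrank ℂ ↥(algebraicClasses S 1) := by
  classical
  have hHT : Huybrechts_K3_hodgeTypes_H2 := Huybrechts_K3_hodgeTypes_H2_holds
  haveI : Module.Finite ℂ (complexBetti S (2 * 1)) := finite_complexBetti hS.isSmoothProjective (2 * 1)
  obtain ⟨hp0, ⟨hpint, hpgen, hηint, hηcup, h20, hline⟩, hPer⟩ := hM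
  have hxpos : 0 < (k3Form (star x) x).re := hPer.2.1
  have hx0 : η.symm x ≠ 0 := fun h0 =>
    ne_zero_of_star_self_re_pos hxpos (by simpa using congrArg η h0)
  have hθsa : ∀ a b : K3Index → ℂ, k3Form (thetaC θ a) b = k3Form a (thetaC θ b) :=
    selfAdjoint_of_zeta9Model hZ.1 hZ.2.2.1 hZ.2.2.2.2.2.2.2
  have he₀ : (((2 * Real.cos (2 * Real.pi / 9) : ℝ)) : ℂ) ≠ 0 := by
    exact_mod_cast two_mul_cos_two_pi_div_nine_pos.ne'
  have hereal : star (((2 * Real.cos (2 * Real.pi / 9) : ℝ)) : ℂ) = ((2 * Real.cos (2 * Real.pi / 9) : ℝ) :) :=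
    Complex.conj_ofReal _
  obtain ⟨σ', hσσ', hσ'σ, hσ', hσ'rat⟩ := exists_inverse_ratIsometry σ hσ hσrat
  set A : complexBetti S (2 * 1) →ₗ[ℂ] (K3Index → ℂ) := σ ∘ₗ η.toLinearMap with hA
  have hAapp : ∀ c, A c = σ (η c) := fun c => rfl
  have hAinj : Function.Injective A := fun a b hab =>
    η.injective (injective_of_k3Form_isometry σ hσ hab)
  set N := algebraicClasses S 1 with hNdef
  -- every rational kernel vector is orthogonal to `σ x` and to its conjugate
  have horth : ∀ q : K3Index → ℚ, thetaC θ (fun i => (q i : ℂ)) = 0 →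
      k3Form (fun i => (q i : ℂ)) (σ x) = 0 ∧ k3Form (fun i => (q i : ℂ)) (star (σ x)) = 0 := by
    intro q hq
    have h1 : (((2 * Real.cos (2 * Real.pi / 9) : ℝ)) : ℂ) * k3Form (fun i => (q i : ℂ)) (σ x) = 0 := by
      rw [← k3Form_smul_right, ← heig, ← hθsa, hq, k3Form_zero_left]
    have heig' : thetaC θ (star (σ x)) = (((2 * Real.cos (2 * Real.pi / 9) : ℝ)) : ℂ) • star (σ x) := by
      rw [thetaC_star, heig, star_smul, hereal]
    have h2 : (((2 * Real.cos (2 * Real.pi / 9) : ℝ)) : ℂ) * k3Form (fun i => (q i : ℂ)) (star (σ x)) = 0 := by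
      rw [← k3Form_smul_right, ← heig', ← hθsa, hq, k3Form_zero_left]
    exact ⟨(mul_eq_zero.1 h1).resolve_left he₀, (mul_eq_zero.1 h2).resolve_left he₀⟩
  -- hence the image of a divisor class
  have hge : LinearMap.ker (thetaC θ) ≤ N.map A := by
    refine (ker_thetaC_le_span_ratCast hZ).trans (Submodule.span_le.2 ?_)
    rintro w ⟨⟨q, rfl⟩, hq⟩
    obtain ⟨hq1, hq2⟩ := horth q hq
    obtain ⟨q', hq'⟩ := ratEnd_ratCast σ' hσ'rat q
    set d : complexBetti S (2 * 1) := η.symm (σ' (fun i => (q i : ℂ))) with hd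
    have hdrat : IsRationalClass d :=
      (isRationalClass_iff_of_marking hS η hηint d).2 ⟨q', by rw [hd, η.apply_symm_apply, hq']⟩
    have hk1 : k3Form (σ' (fun i => (q i : ℂ))) x = 0 := by
      rw [← hσ (σ' _) x, hσσ', hq1]
    have hk2 : k3Form (σ' (fun i => (q i : ℂ))) (star x) = 0 := by
      rw [← hσ (σ' _) (star x), hσσ', ← star_apply_ratIsometry σ hσ hσrat, hq2]
    have hd11 : IsOfHodgeType 2 S (2 * 1) 1 1 d := by
      obtain ⟨-, -, h3⟩ := hHT S hS (η.symm x) h20 hx0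
      refine (h3 d).2 ⟨?_, ?_⟩
      · rw [hηcup, hd, η.apply_symm_apply, η.apply_symm_apply, hk1, zero_smul]
      · rw [conjClass_marking_symm η hηint, hηcup, hd, η.apply_symm_apply, η.apply_symm_apply, hk2, zero_smul]
    refine ⟨d, lefschetzOneOne_rational_holds hS.isSmoothProjective d hdrat hd11, ?_⟩
    rw [hAapp, hd, η.apply_symm_apply, hσσ']
  calc 10 = Module.finrank ℂ (LinearMap.ker (thetaC θ)) := (finrank_ker_thetaC_of_zeta9Model hZ).symm
    _ ≤ Module.finrank ℂ ↥(N.map A) := Submodule.finrank_mono hge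
    _ = Module.finrank ℂ ↥N := (LinearEquiv.finrank_eq (Submodule.equivMapOfInjective A hAinj N)).symm

/-- **HC⁴(S ⊗ S) for EVERY K3 surface on the ζ₉ real-multiplication Hodge locus.** THERE IS a ζ₉ datum
`(g, y₀, θ)` (an integral isometry `g` of the K3 lattice of order dividing `9` with cube-fixed part of rank
`10`, a period point `y₀` with `g y₀ = e^{2πi/9} y₀`, and the model endomorphism `θ`,
`θ_ℂ = ⅓(2g + 2g⁸ - g² - g⁴ - g⁵ - g⁷)`) such that EVERY projective K3 surface `S`, marked by `(η, p, x)`,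
whose period is carried by a rational isometry `σ` of `Λ_ℚ` onto the Hodge locus of `θ`
(`θ_ℂ(σx) = 2cos(2π/9)·σx`) satisfies `HodgeConjectureFor 4 (S ⊗ S)`. Proof: the ∀-member fact supplies the
datum and the strong open input; the transported cycle `Θ` (`exists_oneCycle_of_openAll`) is rational,
type-preserving, cycle-induced, with `(2,0)`-eigenvalue `2cos(2π/9)` of degree `3` over `ℚ`
(`minpoly_eq_cubic`); `ρ(S) ≥ 10` (`ten_le_finrank_algebraicClasses_of_zeta9Locus`) makes the degree law
`3jm + ρ(S) ≠ 22` hold, and `OneCycle.hodgeConjectureFor_square_of_oneCycle_natDegree_of_buskin` concludes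
(generation, or CM and Buskin). Covers in ONE statement the very general points (`ρ = 10`, gen 12's
`exists_zeta9Type_hodgeConjectureFor_square_of_conj`), the Noether–Lefschetz-special points (`ρ = 13`:
cubic RM by `ℚ(ζ₉ + ζ₉⁻¹)` with `F`-ternary form represented by the model's — the cell's rung «RungRank13»)
and the CM points (`ρ = 16`). CONDITIONAL on `Buskin2019_hodgeIsometry_algebraic`,
`Huybrechts_K3_marking_exists` and `VanGeemenSchuett2025_zeta9_cycleOnOpenPeriodSet_everyMember` ONLY;
credits nothing; HC is NOT proved here. [cite: GeemenSchutt2023, Thm. 1.1 (9), §2.4–2.6, §3.4, §4.8, §5.6 and §6.6]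
[cite: ArtebaniComparinValdes2020Order9, Example 3.5] [cite: VanGeemen2008RM, Lemma 3.2]
[cite: Zarhin1983HodgeGroupsK3, Thm. 1.5.1] [cite: Buskin2019, Thm. 1.1] -/
theorem exists_zeta9Locus_hodgeConjectureFor_square
    (hB : Buskin2019_hodgeIsometry_algebraic) (hmark : Huybrechts_K3_marking_exists)
    (hV : VanGeemenSchuett2025_zeta9_cycleOnOpenPeriodSet_everyMember) :
    ∃ (g : Module.End ℂ (K3Index → ℂ)) (y₀ : K3Index → ℂ) (θ : Matrix K3Index K3Index ℚ),
      Zeta9Model[g, y₀, θ] ∧ LocusHC[θ, (2 * Real.cos (2 * Real.pi / 9) : ℝ)] := by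
  obtain ⟨g, y₀, θ, hg, hgint, hg9, hfin, hy₀₀, hy₀p, hgy₀, hθ, U, hU, ⟨y₁, hy₁U, hy₁, h₁₁, h₁p, hy₁gen⟩,
    hcyc⟩ := hV
  have hZ : Zeta9Model[g, y₀, θ] := ⟨hg, hgint, hg9, hfin, hy₀₀, hy₀p, hgy₀, hθ⟩
  refine ⟨g, y₀, θ, hZ, ?_⟩
  intro S hS η p x hM σ hσ hσrat heig
  have hθsa : ∀ a b : K3Index → ℂ, k3Form (thetaC θ a) b = k3Form a (thetaC θ b) :=
    selfAdjoint_of_zeta9Model hg hg9 hθ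
  have hθP := aeval_X_mul_cubic_eq_zero_of_zeta9Model hZ
  have he₀' : (2 * Real.cos (2 * Real.pi / 9) : ℝ) ≠ 0 := two_mul_cos_two_pi_div_nine_pos.ne'
  have he₀ : (((2 * Real.cos (2 * Real.pi / 9) : ℝ)) : ℂ) ≠ 0 := by exact_mod_cast he₀'
  have hx0 : η.symm x ≠ 0 := fun h0 =>
    ne_zero_of_star_self_re_pos hM.2.2.2.1 (by simpa using congrArg η h0)
  have hσx0 : σ x ≠ 0 := ne_zero_of_star_self_re_pos (periodPt_ratIsometry σ hσ hσrat hM.2.2).2.1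
  have hroot := isRoot_map_of_eigen hθP he₀ hσx0 heig
  obtain ⟨π, hπe, hπW⟩ := exists_eigenprojector_certificate (thetaC θ) cubic_separable.map hθP hroot
  have hOpen : OpenAll[θ, (2 * Real.cos (2 * Real.pi / 9) : ℝ)] :=
    ⟨U, hU, ⟨y₁, hy₁U, hy₁, h₁₁, h₁p, hy₁gen⟩, fun y hyU hy hyy hyp =>
      let ⟨S', hS', η', p', hM', hγ'⟩ := hcyc y hyU hy hyy hyp
      ⟨S', hS', η', p', hM', hγ'⟩⟩
  obtain ⟨Θ, hΘrat, hΘtyp, hΘcyc, hΘx⟩ :=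
    exists_oneCycle_of_openAll hB hθsa he₀' hπe hπW hOpen hS η p x hM σ hσ hσrat heig
  -- the eigenvalue has degree `3` over `ℚ`
  have hev3 : (((2 * Real.cos (2 * Real.pi / 9) : ℝ)) : ℂ) ^ 3 - 3 * (((2 * Real.cos (2 * Real.pi / 9) : ℝ)) : ℂ)
      + 1 = 0 := by
    have h2 := hroot
    rw [Polynomial.IsRoot.def, Polynomial.eval_map, ← Polynomial.aeval_def, map_add, map_sub, map_mul, map_pow,
      aeval_X, aeval_C, map_one, map_ofNat] at h2
    exact h2
  have hdeg : (minpoly ℚ (((2 * Real.cos (2 * Real.pi / 9) : ℝ)) : ℂ)).natDegree = 3 := by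
    rw [minpoly_eq_cubic hev3, cubic_natDegree]
  -- the degree law: `3jm + ρ(S) ≠ 22` since `ρ(S) ≥ 10`
  have hρ := ten_le_finrank_algebraicClasses_of_zeta9Locus hZ hS η p x hM σ hσ hσrat heig
  have hk : ∀ j m : ℕ, 2 ≤ j → 3 ≤ m → 3 * j * m + Module.finrank ℂ ↥(algebraicClasses S 1) ≠ 22 := by
    intro j m hj hm
    have : 18 ≤ 3 * j * m := by nlinarith
    omega
  exact OneCycle.hodgeConjectureFor_square_of_oneCycle_natDegree_of_buskin hB hmark hS hk
    complexOrientationFamily Θ hΘrat hΘtyp hΘcyc ⟨η.symm x, _, hM.2.1.2.2.2.2.1, hx0, hΘx, hdeg⟩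

/-! ### The ζ₁₁ locus: HC⁴ of every square -/

/-- **HC⁴(S ⊗ S) for EVERY K3 surface on the ζ₁₁ real-multiplication Hodge locus.** For every ζ₁₁ datum
`(g, u₁, u₂, y₀, θ)` (an integral isometry `g` of `Λ` of order `11` with invariant plane `ℤu₁ ⊕ ℤu₂ ≅ U`, a
period point `y₀` in its `ζ₁₁`-eigenspace, and the model endomorphism `θ`, `θ_ℂ = (g + g¹⁰) - 2π_U`), EVERY
projective K3 surface `S`, marked by `(η, p, x)`, whose period is carried by a rational isometry `σ` of `Λ_ℚ`
onto the Hodge locus of `θ` (`θ_ℂ(σx) = 2cos(2π/11)·σx`) satisfies `HodgeConjectureFor 4 (S ⊗ S)`. Proof: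
the ∀-member fact supplies the strong open input; the transported cycle `Θ` (`exists_oneCycle_of_openAll`)
is rational, type-preserving, cycle-induced, with `(2,0)`-eigenvalue `2cos(2π/11)` — a root of
`Q₁₁ = (X - 2)·P₁₁` other than `2`, hence of the irreducible quintic `P₁₁`, of degree `5` over `ℚ`
(`minpoly_natDegree_eq_five`); the degree law `5jm + ρ(S) ≠ 22` is automatic (`5jm ≥ 30`), and
`OneCycle.hodgeConjectureFor_square_of_oneCycle_natDegree_of_buskin` concludes. Covers the very general
points (`ρ = 2`, gen 11), the Noether–Lefschetz-special points (`ρ = 7`: quintic RM by `ℚ(ζ₁₁ + ζ₁₁⁻¹)`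
with `F`-ternary form represented by the model's `U^⊥ ⊗ ℚ` — the terminal type `(7,5,3)`) and the CM
points (`ρ = 12`) in ONE statement. CONDITIONAL on `Buskin2019_hodgeIsometry_algebraic`,
`Huybrechts_K3_marking_exists` and `VanGeemenSchuett2025_OguisoZhang2011_zeta11_cycleOnOpenPeriodSet_everyMember`
ONLY; credits nothing; HC is NOT proved here. [cite: GeemenSchutt2023, Thm. 1.1 (11), §3.4, §4.8, §5.8 and §6.6]
[cite: OguisoZhang2011K3Order11, Thm. 1.5 (3)] [cite: VanGeemen2008RM, Lemma 3.2]
[cite: Zarhin1983HodgeGroupsK3, Thm. 1.5.1] [cite: Buskin2019, Thm. 1.1] -/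
theorem hodgeConjectureFor_square_of_zeta11Locus
    (hB : Buskin2019_hodgeIsometry_algebraic) (hmark : Huybrechts_K3_marking_exists)
    (hV : VanGeemenSchuett2025_OguisoZhang2011_zeta11_cycleOnOpenPeriodSet_everyMember)
    (hZ : Zeta11Model[g, u₁, u₂, y₀, θ]) : LocusHC[θ, (2 * Real.cos (2 * Real.pi / 11) : ℝ)] := by
  intro S hS η p x hM σ hσ hσrat heig
  have hθP := aeval_X_mul_sextic_eq_zero_of_zeta11Model hZ
  have hθsa := thetaC_selfAdjoint_of_zeta11Model hZ
  obtain ⟨hg, hgint, hg11, hgu₁, hgu₂, hu₁, hu₂, hu₁₂, hfix, hy₀₀, hy₀p, hgy₀, hθ⟩ := hZ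
  obtain ⟨U, hU, ⟨y₁, hy₁U, hy₁, h₁₁, h₁p, hy₁gen⟩, hcyc⟩ :=
    hV g u₁ u₂ y₀ θ hg hgint hg11 hgu₁ hgu₂ hu₁ hu₂ hu₁₂ hfix hy₀₀ hy₀p hgy₀ hθ
  have he₀' : (2 * Real.cos (2 * Real.pi / 11) : ℝ) ≠ 0 := two_mul_cos_two_pi_div_eleven_pos.ne'
  have he₀ : (((2 * Real.cos (2 * Real.pi / 11) : ℝ)) : ℂ) ≠ 0 := by exact_mod_cast he₀'
  have hx0 : η.symm x ≠ 0 := fun h0 =>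
    ne_zero_of_star_self_re_pos hM.2.2.2.1 (by simpa using congrArg η h0)
  have hσx0 : σ x ≠ 0 := ne_zero_of_star_self_re_pos (periodPt_ratIsometry σ hσ hσrat hM.2.2).2.1
  have hrootQ := isRoot_map_of_eigen hθP he₀ hσx0 heig
  obtain ⟨π, hπe, hπW⟩ := exists_eigenprojector_certificate (thetaC θ) sextic_separable.map hθP hrootQ
  have hOpen : OpenAll[θ, (2 * Real.cos (2 * Real.pi / 11) : ℝ)] :=
    ⟨U, hU, ⟨y₁, hy₁U, hy₁, h₁₁, h₁p, hy₁gen⟩, fun y hyU hy hyy hyp =>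
      let ⟨S', hS', η', p', hM', hγ'⟩ := hcyc y hyU hy hyy hyp
      ⟨S', hS', η', p', hM', hγ'⟩⟩
  obtain ⟨Θ, hΘrat, hΘtyp, hΘcyc, hΘx⟩ :=
    exists_oneCycle_of_openAll hB hθsa he₀' hπe hπW hOpen hS η p x hM σ hσ hσrat heig
  -- the eigenvalue is a root of `P₁₁` (a root of `Q₁₁` other than `2`), hence of degree `5` over `ℚ`
  have hrootP : ((P₁₁).map (algebraMap ℚ ℂ)).IsRoot (((2 * Real.cos (2 * Real.pi / 11) : ℝ)) : ℂ) := by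
    rw [Polynomial.IsRoot.def, Polynomial.map_mul, Polynomial.eval_mul, mul_eq_zero] at hrootQ
    rcases hrootQ with h | h
    · rw [Polynomial.map_sub, Polynomial.map_X, Polynomial.map_C, Polynomial.eval_sub, Polynomial.eval_X,
        Polynomial.eval_C, sub_eq_zero] at h
      exact absurd (by simpa using h) two_mul_cos_two_pi_div_eleven_ne_two
    · exact h
  have hev5 : (((2 * Real.cos (2 * Real.pi / 11) : ℝ)) : ℂ) ^ 5 + (((2 * Real.cos (2 * Real.pi / 11) : ℝ)) : ℂ) ^ 4
      - 4 * (((2 * Real.cos (2 * Real.pi / 11) : ℝ)) : ℂ) ^ 3 - 3 * (((2 * Real.cos (2 * Real.pi / 11) : ℝ)) : ℂ) ^ 2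
      + 3 * (((2 * Real.cos (2 * Real.pi / 11) : ℝ)) : ℂ) + 1 = 0 := by
    have h2 := hrootP
    rw [Polynomial.IsRoot.def, Polynomial.eval_map, ← Polynomial.aeval_def] at h2
    simp only [map_add, map_sub, map_mul, map_pow, aeval_X, map_one, map_ofNat] at h2
    linear_combination h2
  have hdeg : (minpoly ℚ (((2 * Real.cos (2 * Real.pi / 11) : ℝ)) : ℂ)).natDegree = 5 :=
    minpoly_natDegree_eq_five hev5
  have hk : ∀ j m : ℕ, 2 ≤ j → 3 ≤ m → 5 * j * m + Module.finrank ℂ ↥(algebraicClasses S 1) ≠ 22 :=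
    fun j m hj hm => OneCycle.mul_mul_add_ne_of_lt_six_mul (by omega) hj hm
  exact OneCycle.hodgeConjectureFor_square_of_oneCycle_natDegree_of_buskin hB hmark hS hk
    complexOrientationFamily Θ hΘrat hΘtyp hΘcyc ⟨η.symm x, _, hM.2.1.2.2.2.2.1, hx0, hΘx, hdeg⟩

end Summit.HodgeConjecture.HodgeConjecture.Theorems.MarkmanPartnerTransport.RMTypeOrbit

end
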